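import Mathlib
import Summits.Ventures.PercRepro2.SharpHalves

/-!
# The halves as statements: HALF-L, HALF-H, and (HCOV) ⟸ HALF-L ∧ HALF-H (blind cell PercRepro2, night-1 g35)

`SharpHalves.Gc_eq_halves` writes the crux functional as `Gc = ΓLc + ΓHc`, `ΓHc` the root mirror of
`ΓLc`.  This file names the two halves as statements and records the closure chain:

* **`HalfL`** `:= 0 ≤ ΓLc` (the `L`-half: `Cov_Q(1_{bL}, F) ≥ (D/P(Q)) Cov_PD(1_{bL}, 1_{o∈U})`,
  cleared), **`HalfH`** `:= HalfL` with the roots exchanged (`= 0 ≤ ΓHc`);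
* **`HCov_of_HalfL_HalfH`**: (HCOV) for every instance on which both halves hold;
* **`HalfL_all`** and **`HCov_all_of_HalfL_all`**: the closure form — the crux of record (HCOV) follows
  from HALF-L for every finite graph and every labelling (HALF-H is the root swap of HALF-L).

Census (night-1 g35, own code, kit adversary with exact re-check): HALF-L and HALF-H survive 29,440 graphs /
117,760 weight climbs (random `n = 5–8`, the non-reducible class `n = 7–8`, `K₆`, `n = 9–10`), 0 float
negatives; the centring family `Ξ_c` places them between the theorem at `c = 1` (`HalfEndpoint.endpoint_one`)
and the refuted sharp centring `c₀` (`SharpHalvesRefutation`).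
-/

namespace Summit.Ventures.PercRepro2

namespace SharpHalves

open CovForm

section Defs

variable {V : Type*} {E : Type*} [Fintype E] [DecidableEq E] [DecidableEq V] {R : Type*}
  [Field R] [LinearOrder R]

/-- **HALF-L**: `0 ≤ ΓLc`. -/
def HalfL (p : E → R) (ends : E → Sym2 V) (o a₁ a₂ a₃ b : V) : Prop :=
  0 ≤ GammaLc p ends o a₁ a₂ a₃ b

/-- **HALF-H**: `0 ≤ ΓHc`, i.e. HALF-L with the roots exchanged. -/
def HalfH (p : E → R) (ends : E → Sym2 V) (o a₁ a₂ a₃ b : V) : Prop :=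
  0 ≤ GammaHc p ends o a₁ a₂ a₃ b

omit [DecidableEq V] in
/-- HALF-H is HALF-L with the roots exchanged. -/
lemma HalfH_iff (p : E → R) (ends : E → Sym2 V) (o a₁ a₂ a₃ b : V) :
    HalfH p ends o a₁ a₂ a₃ b ↔ HalfL p ends o a₂ a₁ a₃ b := Iff.rfl

end Defs

section Closure

variable (R : Type*) [Field R] [LinearOrder R] [IsStrictOrderedRing R]

/-- **HALF-L for every finite graph and every labelling.** -/
def HalfL_all : Prop :=
  ∀ (V E : Type) [Fintype V] [DecidableEq V] [Fintype E] [DecidableEq E]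
    (ends : E → Sym2 V) (p : E → R), IsProbVec p →
    ∀ o a₁ a₂ a₃ b : V, a₁ ≠ a₂ → a₁ ≠ a₃ → a₂ ≠ a₃ → o ≠ a₁ → o ≠ a₂ → o ≠ a₃ → o ≠ b →
      b ≠ a₁ → b ≠ a₂ → b ≠ a₃ → HalfL p ends o a₁ a₂ a₃ b

end Closure

section Chain

variable {V : Type*} {E : Type*} [Fintype E] [DecidableEq E] [DecidableEq V] {R : Type*}
  [Field R] [LinearOrder R] [IsStrictOrderedRing R]

omit [DecidableEq V] in
/-- **(HCOV) ⟸ HALF-L ∧ HALF-H** on any instance. -/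
theorem HCov_of_HalfL_HalfH (p : E → R) (ends : E → Sym2 V) (o a₁ a₂ a₃ b : V)
    (hL : HalfL p ends o a₁ a₂ a₃ b) (hH : HalfH p ends o a₁ a₂ a₃ b) :
    HCov p ends o a₁ a₂ a₃ b := by
  unfold HCov
  rw [Gc_eq_halves]
  exact add_nonneg hL hH

end Chain

section ClosureChain

variable (R : Type*) [Field R] [LinearOrder R] [IsStrictOrderedRing R]

/-- **The closure form: `HCov_all ⟸ HalfL_all`** (HALF-H is the root swap of HALF-L, so the
labelling-free hypothesis covers both halves). -/
theorem HCov_all_of_HalfL_all (h : HalfL_all R) : HCov_all R := by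
  intro V E _ _ _ _ ends p hp o a₁ a₂ a₃ b h12 h13 h23 ho1 ho2 ho3 hob hb1 hb2 hb3
  exact HCov_of_HalfL_HalfH p ends o a₁ a₂ a₃ b
    (h V E ends p hp o a₁ a₂ a₃ b h12 h13 h23 ho1 ho2 ho3 hob hb1 hb2 hb3)
    (h V E ends p hp o a₂ a₁ a₃ b h12.symm h23 h13 ho2 ho1 ho3 hob hb2 hb1 hb3)

end ClosureChain

end SharpHalves

end Summit.Ventures.PercRepro2
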